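import Literature.NumberTheory.Sieve.GreenTao2008SelbergDiagonal
import Literature.NumberTheory.Sieve.SmoothMajorantEuler
import HarnessLib

/-!
# Green–Tao (2008), §10: the `m`-fold correlation sum against the `m`-th power of the `m = 1` sum

Everything in this file is PROVED. Fifth brick of the elementary proof of Green–Tao's
Proposition 9.5 (`Literature.NumberTheory.Sieve.GreenTao2008.GoldstonYildirimLinearForms`). After (10.1)–(10.3) of the source
(expansion of `E(∏_i Λ_R(θ_i(x))² | x ∈ B)`, passage to `ℤ_D^t`, Chinese remainder theorem) the
quantity to evaluate is the `2m`-fold sum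

  `T(ω) = ∑_{d_1,…,d_m,d'_1,…,d'_m ≤ R} ∏_i μ(d_i) log(R/d_i) μ(d'_i) log(R/d'_i) ∏_p ω_p(X_p(d) ∪ X_p(d'))`

(`correlationSum`), `X_p(d) = {i : p ∣ d_i}`, where the local densities `ω_p(X)` (the source's
`ω_X(p)`, (10.3)) satisfy Lemma 10.1: `ω_p(∅) = 1`; `ω_p(X) = 0` for `p ∣ W`, `X ≠ ∅`; and for
`p ∤ W`, `ω_p({i}) = 1/p` and `0 ≤ ω_p(X) ≤ p⁻²` when `|X| ≥ 2` (`IsLocalDensitySystem`). Instead of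
the Euler product and contour integral of the source ((10.4)–(10.9), Lemmas 10.3–10.4) we compare
`T(ω)` with `T(ι)` for the "independent" densities `ι_p(X) = ∏_{i ∈ X} ω_p({i})`:

* `correlationSum_indep`: `T(ι) = S_W(R)^m` (`S_W` of `GreenTao2008SelbergDiagonal`) — the sum
  factorises over `i`;
* `abs_correlationSum_sub_pow_le`: **the comparison**
  `|T(ω) - S_W(R)^m| ≤ (C₀² (W/φ(W))² G(R))^m (∏_{p ≤ R, p ∤ W} (1 + 16^m/p²) - 1)`,
  `G(R) = ∑_{r ≤ R} μ²(r)/φ(r)`, `C₀ = sup |M₁|`: expand `∏_p (ι_p + η_p)` over the set `S` of primes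
  carrying an `η_p = ω_p - ι_p` (`|η_p| ≤ p⁻²`, `η_p = 0` unless `p ∤ W` and `|X| ≥ 2`), fix the
  divisibility pattern of the tuple at the primes of `S` (`4^{m|S|}` patterns), factorise the
  remaining sum over `i` into bilinear forms `B_{W∏S}(R/g, R/g')` (substituting `d = g d̃` with
  `g` the `S`-part) and bound those by Cauchy–Schwarz and the crude bound of
  `GreenTao2008SelbergDiagonal`;
* `prod_one_add_div_sq_sub_one_le`: `∏_{w < p ≤ R}(1 + 16^m/p²) - 1 ≤ 2 · 16^m / w` for `w ≥ 16^m`.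

With `S_W(R) = (1+o(1)) (W/φ(W)) log R` (`GreenTao2008SelbergMainTerm`) and `G(R) ≪ log R` this gives
`T(ω) = (1 + o(1)) (W log R/φ(W))^m` as `w → ∞`, uniformly in the system — the content of
Proposition 9.5 (assembled in `GreenTao2008LinearFormsHolds`).

## References

* B. Green, T. Tao, Ann. of Math. 167 (2008), §10, (10.1)–(10.3), Lemma 10.1, (10.8).
  [cite: GreenTaoAnnals2008]
-/

noncomputable section

open Real Finset ArithmeticFunction
open scoped ArithmeticFunction.Moebius

namespace Literature.NumberTheory.Sieve.GreenTao2008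

open Literature.NumberTheory.Sieve.CFZ

variable {m : ℕ}

/-! ### The objects -/

/-- The Goldston–Yıldırım coefficient `μ(d) log(R/d)` (for `d ≤ R`). [cite: GreenTaoAnnals2008, Definition 9.2] -/
def gyCoeff (R : ℝ) (d : ℕ) : ℝ := (μ d : ℝ) * Real.log (R / d)

/-- The box of `2m`-tuples `(d_1,…,d_m,d'_1,…,d'_m)` with `1 ≤ d ≤ ⌊R⌋` (slots `[m] ⊔ [m]`).
[cite: GreenTaoAnnals2008, Section 10 eq. (10.1)] -/
def tupleBox (m : ℕ) (R : ℝ) : Finset (Fin m ⊕ Fin m → ℕ) :=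
  Fintype.piFinset fun _ : Fin m ⊕ Fin m => Finset.Icc 1 ⌊R⌋₊

/-- The primes `≤ ⌊R⌋` (all prime factors of the entries of a tuple of the box).
[cite: GreenTaoAnnals2008, Section 10] -/
def primesUpTo (R : ℝ) : Finset ℕ := Nat.primesLE ⌊R⌋₊

/-- The weight of a tuple for a system of local densities `ω`:
`∏_{p ≤ R} ω_p(X_p(d) ∪ X_p(d'))` (`projPattern (pattern dd p) = {i : p ∣ d_i ∨ p ∣ d'_i}`).
[cite: GreenTaoAnnals2008, Section 10 eq. (10.3)] -/
def tupleWeight (R : ℝ) (ω : ℕ → Finset (Fin m) → ℝ) (dd : Fin m ⊕ Fin m → ℕ) : ℝ :=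
  ∏ p ∈ primesUpTo R, ω p (projPattern (pattern dd p))

/-- **The correlation sum** `T(ω) = ∑_{dd} (∏_v μ(dd_v) log(R/dd_v)) ∏_p ω_p(X_p ∪ X'_p)` (the left
side of (10.2) with the local densities of (10.3) abstracted). [cite: GreenTaoAnnals2008, Section 10 eq. (10.2)] -/
def correlationSum (m : ℕ) (R : ℝ) (ω : ℕ → Finset (Fin m) → ℝ) : ℝ :=
  ∑ dd ∈ tupleBox m R, (∏ v, gyCoeff R (dd v)) * tupleWeight R ω dd

/-- The independent densities `ι_p(X) = ∏_{i ∈ X} ω_p({i})`. [cite: GreenTaoAnnals2008, Section 10 eq. (10.8)] -/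
def indepDensity (ω : ℕ → Finset (Fin m) → ℝ) (p : ℕ) (X : Finset (Fin m)) : ℝ :=
  ∏ i ∈ X, ω p {i}

/-- **Green–Tao's Lemma 10.1 as a structure**: the local densities of a `W`-tricked non-degenerate
system at the primes `p ≤ R`. [cite: GreenTaoAnnals2008, Lemma 10.1] -/
structure IsLocalDensitySystem (m : ℕ) (R : ℝ) (W : ℕ) (ω : ℕ → Finset (Fin m) → ℝ) : Prop where
  empty : ∀ p, ω p ∅ = 1
  dvd : ∀ p ∈ primesUpTo R, p ∣ W → ∀ X : Finset (Fin m), X.Nonempty → ω p X = 0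
  singleton : ∀ p ∈ primesUpTo R, ¬p ∣ W → ∀ i : Fin m, ω p {i} = 1 / p
  two_le : ∀ p ∈ primesUpTo R, ¬p ∣ W → ∀ X : Finset (Fin m), 2 ≤ X.card → 0 ≤ ω p X ∧ ω p X ≤ 1 / (p : ℝ) ^ 2

/-! ### Elementary facts about the box and the primes -/

/-- Members of `primesUpTo R` are primes. [folklore] -/
theorem prime_of_mem_primesUpTo {R : ℝ} {p : ℕ} (hp : p ∈ primesUpTo R) : p.Prime :=
  (Nat.mem_primesLE.1 hp).2

/-- Membership in `primesUpTo R`. [folklore] -/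
theorem mem_primesUpTo {R : ℝ} {p : ℕ} : p ∈ primesUpTo R ↔ p ≤ ⌊R⌋₊ ∧ p.Prime := Nat.mem_primesLE

/-- The prime factors of `d ≤ ⌊R⌋` lie in `primesUpTo R`. [folklore] -/
theorem primeFactors_subset_primesUpTo {R : ℝ} {d : ℕ} (hd : d ∈ Finset.Icc 1 ⌊R⌋₊) :
    d.primeFactors ⊆ primesUpTo R := fun _ hp =>
  mem_primesUpTo.2 ⟨(Nat.le_of_mem_primeFactors hp).trans (Finset.mem_Icc.1 hd).2, Nat.prime_of_mem_primeFactors hp⟩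

/-- Membership in the box of tuples. [folklore] -/
theorem mem_tupleBox {R : ℝ} {dd : Fin m ⊕ Fin m → ℕ} :
    dd ∈ tupleBox m R ↔ ∀ v, dd v ∈ Finset.Icc 1 ⌊R⌋₊ := Fintype.mem_piFinset

/-! ### Factorisation of a slotwise product over the box -/

/-- `∑_{dd ∈ I^{[m]⊔[m]}} ∏_i F_i(dd(inl i), dd(inr i)) = ∏_i ∑_{d ∈ I} ∑_{e ∈ I} F_i(d, e)`.
[folklore] -/
theorem sum_piFinset_sum_prod_eq (I : Finset ℕ) (F : Fin m → ℕ → ℕ → ℝ) :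
    ∑ dd ∈ Fintype.piFinset (fun _ : Fin m ⊕ Fin m => I), ∏ i, F i (dd (Sum.inl i)) (dd (Sum.inr i)) =
      ∏ i, ∑ d ∈ I, ∑ e ∈ I, F i d e := by
  classical
  -- regroup the slots: `([m] ⊔ [m] → ℕ) ≃ ([m] → ℕ) × ([m] → ℕ)`
  have h1 : ∑ dd ∈ Fintype.piFinset (fun _ : Fin m ⊕ Fin m => I), ∏ i, F i (dd (Sum.inl i)) (dd (Sum.inr i)) =
      ∑ de ∈ (Fintype.piFinset fun _ : Fin m => I) ×ˢ (Fintype.piFinset fun _ : Fin m => I),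
        ∏ i, F i (de.1 i) (de.2 i) := by
    refine Finset.sum_nbij' (fun dd => (fun i => dd (Sum.inl i), fun i => dd (Sum.inr i)))
      (fun de => Sum.elim de.1 de.2) ?_ ?_ ?_ ?_ ?_
    · intro dd hdd
      rw [Fintype.mem_piFinset] at hdd
      simp only [mem_product, Fintype.mem_piFinset]
      exact ⟨fun i => hdd _, fun i => hdd _⟩
    · intro de hde
      simp only [mem_product, Fintype.mem_piFinset] at hde
      rw [Fintype.mem_piFinset]
      rintro (i | i)
      · exact hde.1 i
      · exact hde.2 i
    · intro dd _
      funext v; rcases v with i | i <;> rfl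
    · intro de _
      rfl
    · intro dd _
      rfl
  rw [h1, sum_product]
  -- `∑_d ∑_e ∏_i F_i(d_i, e_i) = ∏_i ∑ ∑ F_i`
  rw [prod_univ_sum]
  refine sum_congr rfl fun d _ => ?_
  rw [prod_univ_sum]

/-! ### The independent model factorises: `T(ι) = S_W(R)^m` -/

/-- For square-free `n` with prime factors in a set of primes `P`: `∏_{p ∈ P, p ∣ n} f(p) = ∏_{p ∣ n} f(p)`.
[folklore] -/
theorem prod_filter_dvd_eq_prod_primeFactors {P : Finset ℕ} (hP : ∀ p ∈ P, p.Prime) {n : ℕ} (hn : n ≠ 0)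
    (hsub : n.primeFactors ⊆ P) (f : ℕ → ℝ) :
    ∏ p ∈ P.filter (· ∣ n), f p = ∏ p ∈ n.primeFactors, f p := by
  refine prod_congr ?_ fun _ _ => rfl
  ext p
  simp only [mem_filter, Nat.mem_primeFactors, ne_eq, hn, not_false_eq_true, and_true]
  exact ⟨fun h => ⟨hP p h.1, h.2⟩, fun h => ⟨hsub (Nat.mem_primeFactors.2 ⟨h.1, h.2, hn⟩), h.2⟩⟩

/-- `lcm` of square-free numbers is square-free. [folklore] -/
theorem squarefree_lcm_of_squarefree {d e : ℕ} (hd : Squarefree d) (he : Squarefree e) :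
    Squarefree (Nat.lcm d e) := by
  have hd0 : d ≠ 0 := hd.ne_zero
  have he0 : e ≠ 0 := he.ne_zero
  rw [Nat.squarefree_iff_factorization_le_one (Nat.lcm_ne_zero hd0 he0)]
  intro p
  rw [Nat.factorization_lcm hd0 he0, Finsupp.sup_apply]
  exact sup_le ((Nat.squarefree_iff_factorization_le_one hd0).1 hd p)
    ((Nat.squarefree_iff_factorization_le_one he0).1 he p)

/-- Prime factors of an `lcm`. [folklore] -/
theorem primeFactors_lcm_eq {d e : ℕ} (hd : d ≠ 0) (he : e ≠ 0) :
    (Nat.lcm d e).primeFactors = d.primeFactors ∪ e.primeFactors := by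
  classical
  rw [← Nat.support_factorization, Nat.factorization_lcm hd he, Finsupp.support_sup, Nat.support_factorization,
    Nat.support_factorization]

/-- `∏_{p ∣ n} 1/p = 1/n` for square-free `n`. [folklore] -/
theorem prod_primeFactors_one_div {n : ℕ} (hn : Squarefree n) :
    ∏ p ∈ n.primeFactors, (1 / (p : ℝ)) = 1 / (n : ℝ) := by
  rw [prod_div_distrib, prod_const_one, ← Nat.cast_prod, Nat.prod_primeFactors_of_squarefree hn]

/-- For square-free `d, e ≤ R` and a local density system: `∏_{p ≤ R, p ∣ lcm(d,e)} ω_p({i}) = 1_{(de,W)=1}/lcm(d,e)`.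
[cite: GreenTaoAnnals2008, Lemma 10.1] -/
theorem prod_singleton_density_eq {R : ℝ} {W : ℕ} {ω : ℕ → Finset (Fin m) → ℝ}
    (hω : IsLocalDensitySystem m R W ω) (i : Fin m) {d e : ℕ} (hd : d ∈ Finset.Icc 1 ⌊R⌋₊)
    (he : e ∈ Finset.Icc 1 ⌊R⌋₊) (hsd : Squarefree d) (hse : Squarefree e) :
    ∏ p ∈ (primesUpTo R).filter (· ∣ Nat.lcm d e), ω p {i} =
      if (d * e).Coprime W then 1 / (Nat.lcm d e : ℝ) else 0 := by
  have hd0 : d ≠ 0 := by have := (Finset.mem_Icc.1 hd).1; omega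
  have he0 : e ≠ 0 := by have := (Finset.mem_Icc.1 he).1; omega
  have hl0 : Nat.lcm d e ≠ 0 := Nat.lcm_ne_zero hd0 he0
  have hlsq : Squarefree (Nat.lcm d e) := squarefree_lcm_of_squarefree hsd hse
  have hsub : (Nat.lcm d e).primeFactors ⊆ primesUpTo R := by
    rw [primeFactors_lcm_eq hd0 he0]
    exact union_subset (primeFactors_subset_primesUpTo hd) (primeFactors_subset_primesUpTo he)
  rw [prod_filter_dvd_eq_prod_primeFactors (fun p hp => prime_of_mem_primesUpTo hp) hl0 hsub]
  by_cases hcop : (d * e).Coprime W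
  · rw [if_pos hcop]
    have hval : ∀ p ∈ (Nat.lcm d e).primeFactors, ω p {i} = 1 / p := by
      intro p hp
      have hpr : p.Prime := Nat.prime_of_mem_primeFactors hp
      have hpl : p ∣ d * e := (Nat.dvd_of_mem_primeFactors hp).trans (Nat.lcm_dvd_mul d e)
      have hpW : ¬p ∣ W := (Nat.Prime.coprime_iff_not_dvd hpr).1 (Nat.Coprime.coprime_dvd_left hpl hcop)
      exact hω.singleton p (hsub hp) hpW i
    rw [prod_congr rfl hval, prod_primeFactors_one_div hlsq]
  · rw [if_neg hcop]
    -- some prime `p ∣ W` divides `de`, hence `lcm(d,e)`, and `ω_p({i}) = 0`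
    obtain ⟨p, hp, hpde, hpW⟩ := Nat.Prime.not_coprime_iff_dvd.1 hcop
    have hpl : p ∣ Nat.lcm d e := by
      rcases (Nat.Prime.dvd_mul hp).1 hpde with h | h
      · exact h.trans (Nat.dvd_lcm_left d e)
      · exact h.trans (Nat.dvd_lcm_right d e)
    have hpmem : p ∈ (Nat.lcm d e).primeFactors := Nat.mem_primeFactors.2 ⟨hp, hpl, hl0⟩
    exact prod_eq_zero hpmem (hω.dvd p (hsub hpmem) hpW {i} (singleton_nonempty i))

/-- A prime divides `lcm(d,e)` iff it divides `d` or `e`. [folklore] -/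
theorem prime_dvd_lcm_iff {p d e : ℕ} (hp : p.Prime) :
    p ∣ Nat.lcm d e ↔ p ∣ d ∨ p ∣ e := by
  constructor
  · intro h
    exact (Nat.Prime.dvd_mul hp).1 (h.trans (Nat.lcm_dvd_mul d e))
  · rintro (h | h)
    · exact h.trans (Nat.dvd_lcm_left d e)
    · exact h.trans (Nat.dvd_lcm_right d e)

/-- The set of indices hit at `p`: `i ∈ X_p ∪ X'_p ↔ p ∣ d_i ∨ p ∣ d'_i`. [cite: GreenTaoAnnals2008, Section 10] -/
theorem projPattern_pattern_eq (dd : Fin m ⊕ Fin m → ℕ) (p : ℕ) :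
    projPattern (pattern dd p) = univ.filter fun i : Fin m => p ∣ dd (Sum.inl i) ∨ p ∣ dd (Sum.inr i) := by
  ext i
  simp [projPattern, pattern]

/-- **The weight of the independent model is a product over the indices**:
`∏_p ι_p(X_p ∪ X'_p) = ∏_i ∏_{p ∈ P, p ∣ d_i ∨ p ∣ d'_i} ω_p({i})`, for any finite set of primes `P`
in place of `primesUpTo R`. [cite: GreenTaoAnnals2008, Section 10 eq. (10.8)] -/
theorem prod_indepDensity_eq (P : Finset ℕ) (ω : ℕ → Finset (Fin m) → ℝ) (dd : Fin m ⊕ Fin m → ℕ) :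
    ∏ p ∈ P, indepDensity ω p (projPattern (pattern dd p)) =
      ∏ i : Fin m, ∏ p ∈ P.filter (fun p => p ∣ dd (Sum.inl i) ∨ p ∣ dd (Sum.inr i)), ω p {i} := by
  unfold indepDensity
  have h : ∀ p, ∏ i ∈ projPattern (pattern dd p), ω p {i} =
      ∏ i : Fin m, if p ∣ dd (Sum.inl i) ∨ p ∣ dd (Sum.inr i) then ω p {i} else 1 := by
    intro p
    rw [projPattern_pattern_eq, prod_filter]
  simp_rw [h]
  rw [Finset.prod_comm]
  exact Fintype.prod_congr _ _ fun i => by rw [prod_filter]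

/-- **`T(ι) = S_W(R)^m`**: the independent model factorises over the indices, each factor being
`∑_{d,e ≤ R} a_W(R;d) a_W(R;e)/lcm(d,e) = S_W(R)`. [cite: GreenTaoAnnals2008, Section 10 eq. (10.8)] -/
theorem correlationSum_indep {R : ℝ} {W : ℕ} {ω : ℕ → Finset (Fin m) → ℝ}
    (hω : IsLocalDensitySystem m R W ω) :
    correlationSum m R (indepDensity ω) = selbergS W R ^ m := by
  classical
  unfold correlationSum tupleWeight
  set F : ℕ → ℕ → ℝ := fun d e => selbergCoeff W R d * selbergCoeff W R e / (Nat.lcm d e : ℝ) with hF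
  have hterm : ∀ dd ∈ tupleBox m R, (∏ v, gyCoeff R (dd v)) * ∏ p ∈ primesUpTo R, indepDensity ω p (projPattern (pattern dd p)) =
      ∏ i : Fin m, F (dd (Sum.inl i)) (dd (Sum.inr i)) := by
    intro dd hdd
    rw [mem_tupleBox] at hdd
    by_cases hsq : ∀ v, Squarefree (dd v)
    · rw [prod_indepDensity_eq, Fintype.prod_sum_type, ← prod_mul_distrib, ← prod_mul_distrib]
      refine Fintype.prod_congr _ _ fun i => ?_
      have hd := hdd (Sum.inl i); have he := hdd (Sum.inr i)
      have hfilt : (primesUpTo R).filter (fun p => p ∣ dd (Sum.inl i) ∨ p ∣ dd (Sum.inr i)) =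
          (primesUpTo R).filter (· ∣ Nat.lcm (dd (Sum.inl i)) (dd (Sum.inr i))) :=
        filter_congr fun p hp => (prime_dvd_lcm_iff (prime_of_mem_primesUpTo hp)).symm
      rw [hfilt, prod_singleton_density_eq hω i hd he (hsq _) (hsq _), hF]
      simp only [gyCoeff, selbergCoeff]
      by_cases h1 : (dd (Sum.inl i)).Coprime W
      · by_cases h2 : (dd (Sum.inr i)).Coprime W
        · rw [if_pos (Nat.Coprime.mul_left h1 h2), if_pos h1, if_pos h2]; ring
        · rw [if_neg (fun h => h2 (Nat.Coprime.coprime_dvd_left (dvd_mul_left _ _) h)), if_pos h1, if_neg h2]; ring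
      · rw [if_neg (fun h => h1 (Nat.Coprime.coprime_dvd_left (dvd_mul_right _ _) h)), if_neg h1]; ring
    · -- a non-square-free entry kills both sides
      push Not at hsq
      obtain ⟨v, hv⟩ := hsq
      have hμ : (μ (dd v) : ℝ) = 0 := by exact_mod_cast ArithmeticFunction.moebius_eq_zero_of_not_squarefree hv
      have hl : (∏ v, gyCoeff R (dd v)) = 0 := prod_eq_zero (mem_univ v) (by rw [gyCoeff, hμ, zero_mul])
      have hr : ∏ i : Fin m, F (dd (Sum.inl i)) (dd (Sum.inr i)) = 0 := by
        have hz : selbergCoeff W R (dd v) = 0 := by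
          unfold selbergCoeff; rw [hμ]; simp
        rcases v with i | i
        · exact prod_eq_zero (mem_univ i) (by rw [hF]; simp only; rw [hz]; simp)
        · exact prod_eq_zero (mem_univ i) (by rw [hF]; simp only; rw [hz]; simp)
      rw [hl, zero_mul, hr]
  rw [sum_congr rfl hterm, tupleBox, sum_piFinset_sum_prod_eq, prod_const, card_univ, Fintype.card_fin]
  rfl

/-! ### The expansion over the set of primes carrying a perturbation -/

/-- The perturbation `η_p = ω_p - ι_p`. [cite: GreenTaoAnnals2008, Section 10 eq. (10.8)] -/
def pertDensity (ω : ℕ → Finset (Fin m) → ℝ) (p : ℕ) (X : Finset (Fin m)) : ℝ :=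
  ω p X - indepDensity ω p X

/-- The partial sums `V(S) = ∑_{dd} (∏ gy) (∏_{p ∈ S} η_p) (∏_{p ∈ P∖S} ι_p)`. [cite: GreenTaoAnnals2008, Section 10] -/
def partialCorrelationSum (m : ℕ) (R : ℝ) (ω : ℕ → Finset (Fin m) → ℝ) (S : Finset ℕ) : ℝ :=
  ∑ dd ∈ tupleBox m R, (∏ v, gyCoeff R (dd v)) *
    ((∏ p ∈ S, pertDensity ω p (projPattern (pattern dd p))) *
      ∏ p ∈ primesUpTo R \ S, indepDensity ω p (projPattern (pattern dd p)))

/-- **`T(ω) = ∑_{S ⊆ P} V(S)`** (`∏_p (η_p + ι_p)` expanded). [cite: GreenTaoAnnals2008, Section 10] -/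
theorem correlationSum_eq_sum_powerset (R : ℝ) (ω : ℕ → Finset (Fin m) → ℝ) :
    correlationSum m R ω = ∑ S ∈ (primesUpTo R).powerset, partialCorrelationSum m R ω S := by
  unfold correlationSum partialCorrelationSum tupleWeight
  rw [sum_comm]
  refine sum_congr rfl fun dd _ => ?_
  rw [← mul_sum]
  congr 1
  rw [← prod_add]
  exact prod_congr rfl fun p _ => by rw [pertDensity]; ring

/-- `V(∅) = T(ι)`. [cite: GreenTaoAnnals2008, Section 10] -/
theorem partialCorrelationSum_empty (R : ℝ) (ω : ℕ → Finset (Fin m) → ℝ) :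
    partialCorrelationSum m R ω ∅ = correlationSum m R (indepDensity ω) := by
  unfold partialCorrelationSum correlationSum tupleWeight
  simp

/-- For `p ∣ W` (a prime of the system): `η_p ≡ 0` (`ω_p(X) = ι_p(X) = [X = ∅]`). [cite: GreenTaoAnnals2008, Lemma 10.1] -/
theorem pertDensity_eq_zero_of_dvd {R : ℝ} {W : ℕ} {ω : ℕ → Finset (Fin m) → ℝ}
    (hω : IsLocalDensitySystem m R W ω) {p : ℕ} (hp : p ∈ primesUpTo R) (hpW : p ∣ W) (X : Finset (Fin m)) :
    pertDensity ω p X = 0 := by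
  unfold pertDensity indepDensity
  rcases X.eq_empty_or_nonempty with rfl | hX
  · rw [hω.empty, Finset.prod_empty, sub_self]
  · rw [hω.dvd p hp hpW X hX]
    obtain ⟨i, hi⟩ := hX
    rw [prod_eq_zero hi (hω.dvd p hp hpW {i} (singleton_nonempty i)), sub_self]

/-- `V(S) = 0` as soon as `S` contains a prime dividing `W`. [cite: GreenTaoAnnals2008, Lemma 10.1] -/
theorem partialCorrelationSum_eq_zero_of_dvd {R : ℝ} {W : ℕ} {ω : ℕ → Finset (Fin m) → ℝ}
    (hω : IsLocalDensitySystem m R W ω) {S : Finset ℕ} (hS : S ⊆ primesUpTo R) {p : ℕ} (hpS : p ∈ S)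
    (hpW : p ∣ W) : partialCorrelationSum m R ω S = 0 := by
  unfold partialCorrelationSum
  refine sum_eq_zero fun dd _ => ?_
  rw [prod_eq_zero hpS (pertDensity_eq_zero_of_dvd hω (hS hpS) hpW _), zero_mul, mul_zero]

/-- **`|η_p(X)| ≤ p⁻²` for every `X`**, for a prime `p ∤ W` of the system (`η_p(X) = 0` if `|X| ≤ 1`;
for `|X| ≥ 2` both `ω_p(X)` and `ι_p(X) = p^{-|X|}` lie in `[0, p⁻²]`). [cite: GreenTaoAnnals2008, Lemma 10.1] -/
theorem abs_pertDensity_le {R : ℝ} {W : ℕ} {ω : ℕ → Finset (Fin m) → ℝ}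
    (hω : IsLocalDensitySystem m R W ω) {p : ℕ} (hp : p ∈ primesUpTo R) (hpW : ¬p ∣ W) (X : Finset (Fin m)) :
    |pertDensity ω p X| ≤ 1 / (p : ℝ) ^ 2 := by
  have hpr := prime_of_mem_primesUpTo hp
  have hp1 : (1 : ℝ) < p := by exact_mod_cast hpr.one_lt
  have hp0 : (0 : ℝ) < p := by linarith
  unfold pertDensity indepDensity
  simp_rw [hω.singleton p hp hpW]
  rw [prod_const]
  rcases Nat.lt_or_ge X.card 2 with h | h
  · -- `|X| ≤ 1`: `ω_p(X) = ι_p(X)`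
    have : |ω p X - (1 / (p : ℝ)) ^ X.card| = 0 := by
      interval_cases hX : X.card
      · rw [card_eq_zero.1 hX, hω.empty]; simp
      · obtain ⟨i, rfl⟩ := card_eq_one.1 hX
        rw [hω.singleton p hp hpW i]; simp
    rw [this]; positivity
  · obtain ⟨h0, h2⟩ := hω.two_le p hp hpW X h
    have hι0 : 0 ≤ (1 / (p : ℝ)) ^ X.card := by positivity
    have hι2 : (1 / (p : ℝ)) ^ X.card ≤ 1 / (p : ℝ) ^ 2 := by
      rw [one_div_pow]
      exact one_div_le_one_div_of_le (by positivity) (pow_le_pow_right₀ hp1.le h)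
    rw [abs_le]; constructor <;> linarith

/-! ### Substituting `d = g d̃` at the primes of `S` -/

/-- A prime divides a product of distinct primes iff it is one of them. [folklore] -/
theorem prime_dvd_prod_primes_iff {A : Finset ℕ} (hA : ∀ p ∈ A, p.Prime) {p : ℕ} (hp : p.Prime) :
    p ∣ ∏ q ∈ A, q ↔ p ∈ A := by
  rw [Prime.dvd_finsetProd_iff hp.prime]
  constructor
  · rintro ⟨a, ha, hpa⟩
    rwa [(Nat.prime_dvd_prime_iff_eq hp (hA a ha)).1 hpa]
  · intro h; exact ⟨p, h, dvd_rfl⟩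

/-- **The substitution `d = (∏ A) d̃`**: the `d ≤ N` whose set of prime divisors from `S` is exactly
`A ⊆ S` correspond to the `d̃ ≤ N/∏A` coprime to `∏ S` (square-free `d`; a summand vanishing off
the square-free numbers sees no difference). [folklore] -/
theorem sum_filter_pattern_eq {S A : Finset ℕ} (hS : ∀ p ∈ S, p.Prime) (hA : A ⊆ S) (N : ℕ) {F : ℕ → ℝ}
    (hF : ∀ d, ¬Squarefree d → F d = 0) :
    ∑ d ∈ (Finset.Icc 1 N).filter (fun d => S.filter (· ∣ d) = A), F d =
      ∑ d ∈ (Finset.Icc 1 (N / ∏ p ∈ A, p)).filter (fun d => d.Coprime (∏ p ∈ S, p)), F ((∏ p ∈ A, p) * d) := by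
  classical
  set g := ∏ p ∈ A, p with hg
  set PS := ∏ p ∈ S, p with hPS
  have hAp : ∀ p ∈ A, p.Prime := fun p hp => hS p (hA hp)
  have hg0 : 0 < g := prod_pos fun p hp => (hAp p hp).pos
  have hgsq : Squarefree g := squarefree_prod_of_primes hAp
  have hgPS : g ∣ PS := prod_dvd_prod_of_subset _ _ _ hA
  have hpg : ∀ {p : ℕ}, p.Prime → (p ∣ g ↔ p ∈ A) := fun hp => prime_dvd_prod_primes_iff hAp hp
  have hpPS : ∀ {p : ℕ}, p.Prime → (p ∣ PS ↔ p ∈ S) := fun hp => prime_dvd_prod_primes_iff hS hp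
  -- restrict both sides to square-free arguments
  have hL : ∑ d ∈ ((Finset.Icc 1 N).filter (fun d => S.filter (· ∣ d) = A)).filter Squarefree, F d =
      ∑ d ∈ (Finset.Icc 1 N).filter (fun d => S.filter (· ∣ d) = A), F d :=
    sum_filter_of_ne fun d _ hne => by by_contra h; exact hne (hF d h)
  have hR : ∑ d ∈ ((Finset.Icc 1 (N / g)).filter (fun d => d.Coprime PS)).filter Squarefree, F (g * d) =
      ∑ d ∈ (Finset.Icc 1 (N / g)).filter (fun d => d.Coprime PS), F (g * d) :=
    sum_filter_of_ne fun d _ hne => by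
      by_contra h
      exact hne (hF _ fun hsq => h (hsq.squarefree_of_dvd (dvd_mul_left d g)))
  rw [← hL, ← hR]
  symm
  refine sum_nbij' (fun d => g * d) (fun d => d / g) ?_ ?_ ?_ ?_ ?_
  · -- `d̃ ↦ g d̃` lands in the left set
    intro d hd
    simp only [mem_filter, Finset.mem_Icc] at hd ⊢
    obtain ⟨⟨⟨hd1, hdN⟩, hcop⟩, hsq⟩ := hd
    have hdg : d.Coprime g := Nat.Coprime.coprime_dvd_right hgPS hcop
    refine ⟨⟨⟨Nat.one_le_iff_ne_zero.2 (Nat.mul_ne_zero hg0.ne' (by omega)), ?_⟩, ?_⟩, ?_⟩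
    · exact (Nat.mul_le_mul_left g hdN).trans (Nat.mul_div_le N g)
    · ext p
      simp only [mem_filter]
      constructor
      · rintro ⟨hpS, hpdvd⟩
        rcases (Nat.Prime.dvd_mul (hS p hpS)).1 hpdvd with h | h
        · exact (hpg (hS p hpS)).1 h
        · exact absurd ((hpPS (hS p hpS)).2 hpS)
            ((Nat.Prime.coprime_iff_not_dvd (hS p hpS)).1 (Nat.Coprime.coprime_dvd_left h hcop))
      · intro hpA
        exact ⟨hA hpA, ((hpg (hAp p hpA)).2 hpA).trans (dvd_mul_right g d)⟩
    · exact Nat.squarefree_mul_iff.2 ⟨hdg.symm, hgsq, hsq⟩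
  · -- `d ↦ d / g` lands in the right set
    intro d hd
    simp only [mem_filter, Finset.mem_Icc] at hd ⊢
    obtain ⟨⟨⟨hd1, hdN⟩, hpat⟩, hsq⟩ := hd
    have hgd : g ∣ d := by
      refine Finset.prod_primes_dvd d (fun p hp => (hAp p hp).prime) fun p hpA => ?_
      have : p ∈ S.filter (· ∣ d) := by rw [hpat]; exact hpA
      exact (mem_filter.1 this).2
    have hd0 : d ≠ 0 := by omega
    refine ⟨⟨⟨?_, Nat.div_le_div_right hdN⟩, ?_⟩, hsq.squarefree_of_dvd (Nat.div_dvd_of_dvd hgd)⟩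
    · exact Nat.div_pos (Nat.le_of_dvd (Nat.pos_of_ne_zero hd0) hgd) hg0
    · refine Nat.coprime_of_dvd fun p hp hpd hpPS' => ?_
      have hpS : p ∈ S := (hpPS hp).1 hpPS'
      have hpd' : p ∣ d := hpd.trans (Nat.div_dvd_of_dvd hgd)
      have hpA : p ∈ A := by
        have : p ∈ S.filter (· ∣ d) := mem_filter.2 ⟨hpS, hpd'⟩
        rwa [hpat] at this
      have hpg' : p ∣ g := (hpg hp).2 hpA
      have hpp : p * p ∣ d := by
        rw [← Nat.mul_div_cancel' hgd]
        exact mul_dvd_mul hpg' hpd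
      exact hp.one_lt.ne' (Nat.isUnit_iff.1 (hsq p hpp))
  · intro d _; exact Nat.mul_div_cancel_left d hg0
  · intro d hd
    simp only [mem_filter, Finset.mem_Icc] at hd
    obtain ⟨⟨⟨hd1, hdN⟩, hpat⟩, hsq⟩ := hd
    have hgd : g ∣ d := by
      refine Finset.prod_primes_dvd d (fun p hp => (hAp p hp).prime) fun p hpA => ?_
      have : p ∈ S.filter (· ∣ d) := by rw [hpat]; exact hpA
      exact (mem_filter.1 this).2
    exact Nat.mul_div_cancel' hgd
  · intro d _; rfl

/-! ### The slot sums after fixing the pattern at the primes of `S` -/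

/-- The density part of a slot sum once the pattern at `S` is fixed: for `d, e ≤ R` coprime to
`∏ S` and square-free, `∏_{p ∈ P∖S, p ∣ gd ∨ p ∣ g'e} ω_p({i}) = 1_{(de,W)=1}/lcm(d,e)` whenever the
primes of `g, g'` lie in `S`. [cite: GreenTaoAnnals2008, Lemma 10.1] -/
theorem prod_sdiff_singleton_density_eq {R : ℝ} {W : ℕ} {ω : ℕ → Finset (Fin m) → ℝ}
    (hω : IsLocalDensitySystem m R W ω) {S : Finset ℕ} (hS : S ⊆ primesUpTo R) (i : Fin m)
    {g g' d e : ℕ} (hg : ∀ p, p.Prime → p ∣ g → p ∈ S) (hg' : ∀ p, p.Prime → p ∣ g' → p ∈ S)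
    (hd : d ∈ Finset.Icc 1 ⌊R⌋₊) (he : e ∈ Finset.Icc 1 ⌊R⌋₊) (hsd : Squarefree d) (hse : Squarefree e)
    (hdS : d.Coprime (∏ p ∈ S, p)) (heS : e.Coprime (∏ p ∈ S, p)) :
    ∏ p ∈ (primesUpTo R \ S).filter (fun p => p ∣ g * d ∨ p ∣ g' * e), ω p {i} =
      if (d * e).Coprime W then 1 / (Nat.lcm d e : ℝ) else 0 := by
  rw [← prod_singleton_density_eq hω i hd he hsd hse]
  refine prod_congr ?_ fun _ _ => rfl
  have hSp : ∀ p ∈ S, p.Prime := fun p hp => prime_of_mem_primesUpTo (hS hp)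
  ext p
  simp only [mem_filter, Finset.mem_sdiff]
  constructor
  · rintro ⟨⟨hpP, hpS⟩, hdvd⟩
    have hp := prime_of_mem_primesUpTo hpP
    refine ⟨hpP, (prime_dvd_lcm_iff hp).2 ?_⟩
    rcases hdvd with h | h
    · rcases (Nat.Prime.dvd_mul hp).1 h with h' | h'
      · exact absurd (hg p hp h') hpS
      · exact Or.inl h'
    · rcases (Nat.Prime.dvd_mul hp).1 h with h' | h'
      · exact absurd (hg' p hp h') hpS
      · exact Or.inr h'
  · rintro ⟨hpP, hdvd⟩
    have hp := prime_of_mem_primesUpTo hpP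
    rw [prime_dvd_lcm_iff hp] at hdvd
    have hpS : p ∉ S := by
      intro hpS
      have hpPS : p ∣ ∏ q ∈ S, q := dvd_prod_of_mem _ hpS
      rcases hdvd with h | h
      · exact (Nat.Prime.coprime_iff_not_dvd hp).1 (Nat.Coprime.coprime_dvd_left h hdS) hpPS
      · exact (Nat.Prime.coprime_iff_not_dvd hp).1 (Nat.Coprime.coprime_dvd_left h heS) hpPS
    refine ⟨⟨hpP, hpS⟩, ?_⟩
    rcases hdvd with h | h
    · exact Or.inl (h.trans (dvd_mul_left d g))
    · exact Or.inr (h.trans (dvd_mul_left e g'))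

/-- **The slot sum with the pattern at `S` fixed is a bilinear Selberg form**:
`∑_{d,e ≤ R} 1[S∩d = A] 1[S∩e = A'] μ(d)log(R/d) μ(e)log(R/e) ∏_{p ∈ P∖S, p∣d ∨ p∣e} ω_p({i})
  = μ(g)μ(g') B_{W∏S}(R/g, R/g')`, `g = ∏A`, `g' = ∏A'`. [cite: GreenTaoAnnals2008, Section 10] -/
theorem slotSum_eq {R : ℝ} {W : ℕ} {ω : ℕ → Finset (Fin m) → ℝ}
    (hω : IsLocalDensitySystem m R W ω) {S : Finset ℕ} (hS : S ⊆ primesUpTo R) (i : Fin m)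
    {A A' : Finset ℕ} (hA : A ⊆ S) (hA' : A' ⊆ S) :
    ∑ d ∈ Finset.Icc 1 ⌊R⌋₊, ∑ e ∈ Finset.Icc 1 ⌊R⌋₊,
      (if S.filter (· ∣ d) = A then (1 : ℝ) else 0) * (if S.filter (· ∣ e) = A' then (1 : ℝ) else 0) *
        (gyCoeff R d * gyCoeff R e) *
          ∏ p ∈ (primesUpTo R \ S).filter (fun p => p ∣ d ∨ p ∣ e), ω p {i} =
      (μ (∏ p ∈ A, p) : ℝ) * (μ (∏ p ∈ A', p) : ℝ) *
        selbergB (W * ∏ p ∈ S, p) (R / ∏ p ∈ A, p) (R / ∏ p ∈ A', p) := by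
  classical
  have hSp : ∀ p ∈ S, p.Prime := fun p hp => prime_of_mem_primesUpTo (hS hp)
  set g := ∏ p ∈ A, p with hgdef
  set g' := ∏ p ∈ A', p with hg'def
  set PS := ∏ p ∈ S, p with hPSdef
  set N := ⌊R⌋₊ with hN
  have hAp : ∀ p ∈ A, p.Prime := fun p hp => hSp p (hA hp)
  have hA'p : ∀ p ∈ A', p.Prime := fun p hp => hSp p (hA' hp)
  have hg0 : 0 < g := prod_pos fun p hp => (hAp p hp).pos
  have hg'0 : 0 < g' := prod_pos fun p hp => (hA'p p hp).pos
  have hgS : ∀ p, p.Prime → p ∣ g → p ∈ S := fun p hp h => hA ((prime_dvd_prod_primes_iff hAp hp).1 h)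
  have hg'S : ∀ p, p.Prime → p ∣ g' → p ∈ S := fun p hp h => hA' ((prime_dvd_prod_primes_iff hA'p hp).1 h)
  have hgPS : g ∣ PS := prod_dvd_prod_of_subset _ _ _ hA
  have hg'PS : g' ∣ PS := prod_dvd_prod_of_subset _ _ _ hA'
  -- the density factor as a function
  set Ω : ℕ → ℕ → ℝ := fun d e => ∏ p ∈ (primesUpTo R \ S).filter (fun p => p ∣ d ∨ p ∣ e), ω p {i} with hΩ
  -- Step 1: pull the indicators into the ranges
  have h1 : ∑ d ∈ Finset.Icc 1 N, ∑ e ∈ Finset.Icc 1 N,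
      (if S.filter (· ∣ d) = A then (1 : ℝ) else 0) * (if S.filter (· ∣ e) = A' then (1 : ℝ) else 0) *
        (gyCoeff R d * gyCoeff R e) * Ω d e =
      ∑ d ∈ (Finset.Icc 1 N).filter (fun d => S.filter (· ∣ d) = A),
        ∑ e ∈ (Finset.Icc 1 N).filter (fun e => S.filter (· ∣ e) = A'), gyCoeff R d * gyCoeff R e * Ω d e := by
    symm
    rw [sum_filter]
    refine sum_congr rfl fun d _ => ?_
    by_cases h : S.filter (· ∣ d) = A
    · rw [if_pos h, sum_filter]
      refine sum_congr rfl fun e _ => ?_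
      by_cases h' : S.filter (· ∣ e) = A'
      · simp only [if_pos h, if_pos h']; ring
      · simp only [if_pos h, if_neg h']; ring
    · rw [if_neg h]
      symm
      refine sum_eq_zero fun e _ => ?_
      rw [if_neg h]; ring
  -- Step 2: substitute in `d`, then in `e`
  have hzero : ∀ {d : ℕ}, ¬Squarefree d → gyCoeff R d = 0 := fun h => by
    rw [gyCoeff, ArithmeticFunction.moebius_eq_zero_of_not_squarefree h]; simp
  have h2 : ∑ d ∈ (Finset.Icc 1 N).filter (fun d => S.filter (· ∣ d) = A),
      ∑ e ∈ (Finset.Icc 1 N).filter (fun e => S.filter (· ∣ e) = A'), gyCoeff R d * gyCoeff R e * Ω d e =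
      ∑ d ∈ (Finset.Icc 1 (N / g)).filter (fun d => d.Coprime PS),
        ∑ e ∈ (Finset.Icc 1 (N / g')).filter (fun e => e.Coprime PS),
          gyCoeff R (g * d) * gyCoeff R (g' * e) * Ω (g * d) (g' * e) := by
    rw [sum_filter_pattern_eq hSp hA N (F := fun d => ∑ e ∈ (Finset.Icc 1 N).filter (fun e => S.filter (· ∣ e) = A'),
      gyCoeff R d * gyCoeff R e * Ω d e)]
    · refine sum_congr rfl fun d _ => ?_
      rw [sum_filter_pattern_eq hSp hA' N (F := fun e => gyCoeff R (g * d) * gyCoeff R e * Ω (g * d) e)]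
      intro e he
      rw [hzero he]; ring
    · intro d hd
      refine sum_eq_zero fun e _ => ?_
      rw [hzero hd]; ring
  -- Step 3: identify the summands with those of `B_{W PS}(R/g, R/g')`
  rw [h1, h2, selbergB, ← Nat.floor_div_natCast, ← Nat.floor_div_natCast, mul_sum, sum_filter]
  have hfl : ∀ k : ℕ, ⌊R / (k : ℝ)⌋₊ ≤ N := fun k => by rw [Nat.floor_div_natCast]; exact Nat.div_le_self _ _
  refine sum_congr rfl fun d hd => ?_
  have hdN : d ∈ Finset.Icc 1 N := by
    simp only [Finset.mem_Icc] at hd ⊢; exact ⟨hd.1, hd.2.trans (hfl g)⟩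
  have hsc0 : ∀ {x : ℕ} (X : ℝ), ¬x.Coprime PS → selbergCoeff (W * PS) X x = 0 := by
    intro x X hx
    unfold selbergCoeff
    rw [if_neg (fun h => hx (Nat.Coprime.coprime_dvd_right (dvd_mul_left PS W) h))]
  by_cases hdS : d.Coprime PS
  · rw [if_pos hdS, mul_sum, sum_filter]
    refine sum_congr rfl fun e he => ?_
    have heN : e ∈ Finset.Icc 1 N := by
      simp only [Finset.mem_Icc] at he ⊢; exact ⟨he.1, he.2.trans (hfl g')⟩
    by_cases heS : e.Coprime PS
    · rw [if_pos heS]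
      by_cases hsd : Squarefree d
      · by_cases hse : Squarefree e
        · -- the generic case
          have hdg : g.Coprime d := (Nat.Coprime.coprime_dvd_right hgPS hdS).symm
          have heg : g'.Coprime e := (Nat.Coprime.coprime_dvd_right hg'PS heS).symm
          have hd0 : (d : ℝ) ≠ 0 := by have := (Finset.mem_Icc.1 hd).1; exact_mod_cast (by omega : d ≠ 0)
          have he0 : (e : ℝ) ≠ 0 := by have := (Finset.mem_Icc.1 he).1; exact_mod_cast (by omega : e ≠ 0)
          have hg0' : (g : ℝ) ≠ 0 := by exact_mod_cast hg0.ne'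
          have hg'0' : (g' : ℝ) ≠ 0 := by exact_mod_cast hg'0.ne'
          have hΩv : Ω (g * d) (g' * e) = if (d * e).Coprime W then 1 / (Nat.lcm d e : ℝ) else 0 := by
            rw [hΩ]
            exact prod_sdiff_singleton_density_eq hω hS i hgS hg'S hdN heN hsd hse hdS heS
          have hgd : gyCoeff R (g * d) = (μ g : ℝ) * (μ d : ℝ) * Real.log (R / g / d) := by
            rw [gyCoeff, moebius_mul_eq, if_pos hdg]; push_cast; rw [← div_div]
          have hge : gyCoeff R (g' * e) = (μ g' : ℝ) * (μ e : ℝ) * Real.log (R / g' / e) := by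
            rw [gyCoeff, moebius_mul_eq, if_pos heg]; push_cast; rw [← div_div]
          rw [hΩv, hgd, hge]
          unfold selbergCoeff
          by_cases hdW : d.Coprime W
          · by_cases heW : e.Coprime W
            · rw [if_pos (Nat.Coprime.mul_left hdW heW), if_pos (Nat.Coprime.mul_right hdW hdS),
                if_pos (Nat.Coprime.mul_right heW heS)]
              ring
            · rw [if_neg (fun h => heW (Nat.Coprime.coprime_dvd_left (dvd_mul_left e d) h)),
                if_neg (fun h => heW (Nat.Coprime.coprime_dvd_right (dvd_mul_right W PS) h))]
              ring
          · rw [if_neg (fun h => hdW (Nat.Coprime.coprime_dvd_left (dvd_mul_right d e) h)),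
              if_neg (fun h => hdW (Nat.Coprime.coprime_dvd_right (dvd_mul_right W PS) h))]
            ring
        · have h0 : gyCoeff R (g' * e) = 0 := hzero fun h => hse (h.squarefree_of_dvd (dvd_mul_left e g'))
          have h0' : selbergCoeff (W * PS) (R / g') e = 0 := by
            unfold selbergCoeff; rw [ArithmeticFunction.moebius_eq_zero_of_not_squarefree hse]; simp
          rw [h0, h0']; ring
      · have h0 : gyCoeff R (g * d) = 0 := hzero fun h => hsd (h.squarefree_of_dvd (dvd_mul_left d g))
        have h0' : selbergCoeff (W * PS) (R / g) d = 0 := by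
          unfold selbergCoeff; rw [ArithmeticFunction.moebius_eq_zero_of_not_squarefree hsd]; simp
        rw [h0, h0']; ring
    · rw [if_neg heS, hsc0 _ heS]; ring
  · rw [if_neg hdS]
    symm
    refine mul_eq_zero_of_right _ (sum_eq_zero fun e _ => ?_)
    rw [hsc0 _ hdS]; ring

/-! ### Fibring `V(S)` over the divisibility patterns at the primes of `S` -/

/-- The pattern of a tuple at the primes of `S`: slot `v ↦ {p ∈ S : p ∣ dd_v}`. [cite: GreenTaoAnnals2008, Section 10] -/
def patOf (S : Finset ℕ) (dd : Fin m ⊕ Fin m → ℕ) : Fin m ⊕ Fin m → Finset ℕ := fun v => S.filter (· ∣ dd v)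

/-- The slots hit by `p` under a pattern `σ`. [cite: GreenTaoAnnals2008, Section 10] -/
def patSet (σ : Fin m ⊕ Fin m → Finset ℕ) (p : ℕ) : Finset (Fin m ⊕ Fin m) := univ.filter fun v => p ∈ σ v

/-- All patterns: functions from the slots to subsets of `S` (`4^{m|S|}` of them). [cite: GreenTaoAnnals2008, Section 10] -/
def patterns (m : ℕ) (S : Finset ℕ) : Finset (Fin m ⊕ Fin m → Finset ℕ) :=
  Fintype.piFinset fun _ : Fin m ⊕ Fin m => S.powerset

/-- The fibre sums `U(S, σ) = ∑_{dd : pattern σ at S} (∏ gy) ∏_{p ∈ P∖S} ι_p`. [cite: GreenTaoAnnals2008, Section 10] -/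
def fiberSum (R : ℝ) (ω : ℕ → Finset (Fin m) → ℝ) (S : Finset ℕ) (σ : Fin m ⊕ Fin m → Finset ℕ) : ℝ :=
  ∑ dd ∈ (tupleBox m R).filter (fun dd => patOf S dd = σ),
    (∏ v, gyCoeff R (dd v)) * ∏ p ∈ primesUpTo R \ S, indepDensity ω p (projPattern (pattern dd p))

/-- At a prime of `S` the divisibility pattern of a tuple is read off its `S`-pattern. [folklore] -/
theorem pattern_eq_patSet {S : Finset ℕ} {p : ℕ} (hp : p ∈ S) (dd : Fin m ⊕ Fin m → ℕ) :
    pattern dd p = patSet (patOf S dd) p := by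
  ext v
  simp [pattern, patSet, patOf, hp]

/-- The `S`-pattern of a tuple is a pattern. [folklore] -/
theorem patOf_mem_patterns (S : Finset ℕ) (dd : Fin m ⊕ Fin m → ℕ) : patOf S dd ∈ patterns m S := by
  rw [patterns, Fintype.mem_piFinset]
  intro v
  exact mem_powerset.2 (filter_subset _ _)

/-- There are `(2^{|S|})^{2m} = 4^{m|S|}` patterns. [folklore] -/
theorem card_patterns (m : ℕ) (S : Finset ℕ) : (patterns m S).card = (2 ^ S.card) ^ (m + m) := by
  rw [patterns, Fintype.card_piFinset, prod_const, card_powerset, card_univ, Fintype.card_sum, Fintype.card_fin]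

/-- **`V(S) = ∑_σ (∏_{p ∈ S} η_p(σ)) U(S, σ)`**. [cite: GreenTaoAnnals2008, Section 10] -/
theorem partialCorrelationSum_eq_sum_patterns (R : ℝ) (ω : ℕ → Finset (Fin m) → ℝ) (S : Finset ℕ) :
    partialCorrelationSum m R ω S =
      ∑ σ ∈ patterns m S, (∏ p ∈ S, pertDensity ω p (projPattern (patSet σ p))) * fiberSum R ω S σ := by
  unfold partialCorrelationSum fiberSum
  rw [← sum_fiberwise_of_maps_to (g := patOf S) (t := patterns m S) (fun dd _ => patOf_mem_patterns S dd)]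
  refine sum_congr rfl fun σ _ => ?_
  rw [mul_sum]
  refine sum_congr rfl fun dd hdd => ?_
  have hσ : patOf S dd = σ := (mem_filter.1 hdd).2
  have hη : ∏ p ∈ S, pertDensity ω p (projPattern (pattern dd p)) =
      ∏ p ∈ S, pertDensity ω p (projPattern (patSet σ p)) :=
    prod_congr rfl fun p hp => by rw [pattern_eq_patSet hp, hσ]
  rw [hη]; ring

/-! ### The fibre sums factorise into bilinear Selberg forms -/

/-- **`U(S, σ) = ∏_i μ(g_i)μ(g'_i) B_{W∏S}(R/g_i, R/g'_i)`** with `g_i = ∏ σ(inl i)`, `g'_i = ∏ σ(inr i)`.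
[cite: GreenTaoAnnals2008, Section 10] -/
theorem fiberSum_eq_prod {R : ℝ} {W : ℕ} {ω : ℕ → Finset (Fin m) → ℝ} (hω : IsLocalDensitySystem m R W ω)
    {S : Finset ℕ} (hS : S ⊆ primesUpTo R) {σ : Fin m ⊕ Fin m → Finset ℕ} (hσ : σ ∈ patterns m S) :
    fiberSum R ω S σ = ∏ i : Fin m, ((μ (∏ p ∈ σ (Sum.inl i), p) : ℝ) * (μ (∏ p ∈ σ (Sum.inr i), p) : ℝ) *
      selbergB (W * ∏ p ∈ S, p) (R / ∏ p ∈ σ (Sum.inl i), p) (R / ∏ p ∈ σ (Sum.inr i), p)) := by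
  classical
  have hσS : ∀ v, σ v ⊆ S := fun v => by
    have h := (Fintype.mem_piFinset.1 hσ) v
    exact mem_powerset.1 h
  -- the fibre as a sum over the whole box against an indicator, which factorises slotwise
  set Φ : Fin m → ℕ → ℕ → ℝ := fun i d e =>
    (if S.filter (· ∣ d) = σ (Sum.inl i) then (1 : ℝ) else 0) * (if S.filter (· ∣ e) = σ (Sum.inr i) then (1 : ℝ) else 0) *
      (gyCoeff R d * gyCoeff R e) *
        ∏ p ∈ (primesUpTo R \ S).filter (fun p => p ∣ d ∨ p ∣ e), ω p {i} with hΦ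
  have hfib : fiberSum R ω S σ = ∑ dd ∈ tupleBox m R, ∏ i, Φ i (dd (Sum.inl i)) (dd (Sum.inr i)) := by
    unfold fiberSum
    rw [sum_filter]
    refine sum_congr rfl fun dd _ => ?_
    have hind : (if patOf S dd = σ then (1 : ℝ) else 0) =
        ∏ v, if S.filter (· ∣ dd v) = σ v then (1 : ℝ) else 0 := by
      rw [prod_boole]
      congr 1
      rw [funext_iff]
      exact propext ⟨fun h i _ => h i, fun h i => h i (mem_univ i)⟩
    have hG : (∏ v, gyCoeff R (dd v)) * ∏ p ∈ primesUpTo R \ S, indepDensity ω p (projPattern (pattern dd p)) =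
        ∏ i, (gyCoeff R (dd (Sum.inl i)) * gyCoeff R (dd (Sum.inr i))) *
          ∏ p ∈ (primesUpTo R \ S).filter (fun p => p ∣ dd (Sum.inl i) ∨ p ∣ dd (Sum.inr i)), ω p {i} := by
      rw [prod_indepDensity_eq, Fintype.prod_sum_type, ← prod_mul_distrib, ← prod_mul_distrib]
    rw [show (if patOf S dd = σ then (∏ v, gyCoeff R (dd v)) *
        ∏ p ∈ primesUpTo R \ S, indepDensity ω p (projPattern (pattern dd p)) else 0) =
        (if patOf S dd = σ then (1 : ℝ) else 0) * ((∏ v, gyCoeff R (dd v)) *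
          ∏ p ∈ primesUpTo R \ S, indepDensity ω p (projPattern (pattern dd p))) by
      split_ifs <;> simp, hind, hG, Fintype.prod_sum_type, ← prod_mul_distrib, ← prod_mul_distrib]
    refine Fintype.prod_congr _ _ fun i => ?_
    rw [hΦ]
    ring
  rw [hfib, tupleBox, sum_piFinset_sum_prod_eq]
  refine Fintype.prod_congr _ _ fun i => ?_
  rw [hΦ]
  exact slotSum_eq hω hS i (hσS _) (hσS _)

/-- `E_1(S) = ∏_{p ∈ S}(1 - 1/p)⁻¹ ≤ 2^{|S|}` for a set of primes `S`. [folklore] -/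
theorem eulerFactorProd_one_le_two_pow {S : Finset ℕ} (hS : ∀ p ∈ S, p.Prime) :
    eulerFactorProd 1 S ≤ 2 ^ S.card := by
  unfold eulerFactorProd
  rw [← prod_const (2 : ℝ)]
  refine prod_le_prod (fun p hp => zero_le_one.trans (one_le_eulerFactor (hS p hp) one_pos)) fun p hp => ?_
  have hp2 : (2 : ℝ) ≤ p := by exact_mod_cast (hS p hp).two_le
  have hp0 : (0 : ℝ) < p := by linarith
  have hhalf : (1 : ℝ) / 2 ≤ 1 - (p : ℝ) ^ (-(1 : ℝ)) := by
    rw [Real.rpow_neg_one]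
    have : (p : ℝ)⁻¹ ≤ 1 / 2 := by rw [inv_eq_one_div, div_le_div_iff₀ hp0 (by norm_num)]; linarith
    linarith
  calc (1 - (p : ℝ) ^ (-(1 : ℝ)))⁻¹ ≤ (1 / 2)⁻¹ := by
        rw [inv_le_inv₀ (by linarith) (by norm_num)]; exact hhalf
    _ = 2 := by norm_num

/-- **The bound for a fibre sum**: `|U(S,σ)| ≤ (C₀² (E_W 2^{|S|})² G(R))^m`, where
`G(R) = ∑_{r ≤ R} μ²(r)/φ(r)`, from `|μ(g)μ(g') B_q(X₁,X₂)| ≤ max(S_q(X₁), S_q(X₂))` (Cauchy–Schwarz),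
the crude bound `S_q(X) ≤ C₀² E_q² G(X)` and `E_q ≤ E_W E_S ≤ E_W 2^{|S|}` (`q = W ∏ S`).
[cite: GreenTaoAnnals2008, Section 10] -/
theorem abs_fiberSum_le {R : ℝ} {W : ℕ} {ω : ℕ → Finset (Fin m) → ℝ} (hω : IsLocalDensitySystem m R W ω)
    (hW : W ≠ 0) {C₀ : ℝ} (hC₀ : ∀ u, |moebiusLogSum u| ≤ C₀)
    {S : Finset ℕ} (hS : S ⊆ primesUpTo R) {σ : Fin m ⊕ Fin m → Finset ℕ} (hσ : σ ∈ patterns m S) :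
    |fiberSum R ω S σ| ≤ (C₀ ^ 2 * (eulerFactorProd 1 W.primeFactors * 2 ^ S.card) ^ 2 *
      ∑ r ∈ (Finset.Icc 1 ⌊R⌋₊).filter Squarefree, 1 / (r.totient : ℝ)) ^ m := by
  classical
  have hSp : ∀ p ∈ S, p.Prime := fun p hp => prime_of_mem_primesUpTo (hS hp)
  set PS := ∏ p ∈ S, p with hPS
  set q := W * PS with hq
  have hPS0 : PS ≠ 0 := (prod_pos fun p hp => (hSp p hp).pos).ne'
  have hq0 : q ≠ 0 := Nat.mul_ne_zero hW hPS0
  set G : ℝ := ∑ r ∈ (Finset.Icc 1 ⌊R⌋₊).filter Squarefree, 1 / (r.totient : ℝ) with hG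
  set EW := eulerFactorProd 1 W.primeFactors with hEW
  have hEW0 : 0 ≤ EW := (eulerFactorProd_pos one_pos (primeFactors_prime W)).le
  -- `E_q ≤ E_W 2^{|S|}`
  have hEq : eulerFactorProd 1 q.primeFactors ≤ EW * 2 ^ S.card := by
    rw [hq, Nat.primeFactors_mul hW hPS0, hPS, Nat.primeFactors_prod hSp]
    refine (eulerFactorProd_union_le one_pos (primeFactors_prime W) hSp).trans ?_
    exact mul_le_mul_of_nonneg_left (eulerFactorProd_one_le_two_pow hSp) hEW0
  have hEq0 : 0 ≤ eulerFactorProd 1 q.primeFactors := (eulerFactorProd_pos one_pos (primeFactors_prime q)).le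
  -- the crude bound at any level `R / k`
  have hSq : ∀ k : ℕ, selbergS q (R / k) ≤ C₀ ^ 2 * (EW * 2 ^ S.card) ^ 2 * G := by
    intro k
    refine (selbergS_le_of_bound hC₀ hq0 _).trans ?_
    have hmono : ∑ r ∈ (Finset.Icc 1 ⌊R / (k : ℝ)⌋₊).filter Squarefree, 1 / (r.totient : ℝ) ≤ G := by
      refine sum_le_sum_of_subset_of_nonneg (fun r hr => ?_) fun r _ _ => by positivity
      simp only [mem_filter, Finset.mem_Icc] at hr ⊢
      refine ⟨⟨hr.1.1, hr.1.2.trans ?_⟩, hr.2⟩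
      rw [Nat.floor_div_natCast]; exact Nat.div_le_self _ _
    have h1 : eulerFactorProd 1 q.primeFactors ^ 2 ≤ (EW * 2 ^ S.card) ^ 2 := pow_le_pow_left₀ hEq0 hEq 2
    have h2 : 0 ≤ ∑ r ∈ (Finset.Icc 1 ⌊R / (k : ℝ)⌋₊).filter Squarefree, 1 / (r.totient : ℝ) :=
      sum_nonneg fun r _ => by positivity
    calc C₀ ^ 2 * eulerFactorProd 1 q.primeFactors ^ 2 * ∑ r ∈ (Finset.Icc 1 ⌊R / (k : ℝ)⌋₊).filter Squarefree, 1 / (r.totient : ℝ)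
        ≤ C₀ ^ 2 * (EW * 2 ^ S.card) ^ 2 * ∑ r ∈ (Finset.Icc 1 ⌊R / (k : ℝ)⌋₊).filter Squarefree, 1 / (r.totient : ℝ) :=
          mul_le_mul_of_nonneg_right (mul_le_mul_of_nonneg_left h1 (sq_nonneg _)) h2
      _ ≤ C₀ ^ 2 * (EW * 2 ^ S.card) ^ 2 * G := mul_le_mul_of_nonneg_left hmono (by positivity)
  rw [fiberSum_eq_prod hω hS hσ, abs_prod]
  refine le_trans (prod_le_prod (fun i _ => abs_nonneg _) fun i _ => ?_)
    (le_of_eq (by rw [prod_const, card_univ, Fintype.card_fin]))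
  have hμ1 : ∀ n : ℕ, |(μ n : ℝ)| ≤ 1 := fun n => by exact_mod_cast ArithmeticFunction.abs_moebius_le_one
  rw [abs_mul, abs_mul]
  have hB := abs_selbergB_le_max q (R / ((∏ p ∈ σ (Sum.inl i), p : ℕ) : ℝ)) (R / ((∏ p ∈ σ (Sum.inr i), p : ℕ) : ℝ))
  have hB' : |selbergB q (R / ((∏ p ∈ σ (Sum.inl i), p : ℕ) : ℝ)) (R / ((∏ p ∈ σ (Sum.inr i), p : ℕ) : ℝ))| ≤
      C₀ ^ 2 * (EW * 2 ^ S.card) ^ 2 * G := hB.trans (max_le (hSq _) (hSq _))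
  calc |(μ (∏ p ∈ σ (Sum.inl i), p) : ℝ)| * |(μ (∏ p ∈ σ (Sum.inr i), p) : ℝ)| *
        |selbergB q (R / ((∏ p ∈ σ (Sum.inl i), p : ℕ) : ℝ)) (R / ((∏ p ∈ σ (Sum.inr i), p : ℕ) : ℝ))|
      ≤ 1 * 1 * (C₀ ^ 2 * (EW * 2 ^ S.card) ^ 2 * G) := by
        refine mul_le_mul (mul_le_mul (hμ1 _) (hμ1 _) (abs_nonneg _) zero_le_one) hB' (abs_nonneg _) (by norm_num)
    _ = C₀ ^ 2 * (EW * 2 ^ S.card) ^ 2 * G := by ring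

/-! ### Assembly of the comparison -/

/-- **`|V(S)| ≤ (C₀² E_W² G(R))^m ∏_{p ∈ S} 16^m/p²`** for a set `S` of primes `p ≤ R` not dividing `W`
(`4^{m|S|}` patterns, `|η_p| ≤ p⁻²`, and the fibre bound). [cite: GreenTaoAnnals2008, Section 10] -/
theorem abs_partialCorrelationSum_le {R : ℝ} {W : ℕ} {ω : ℕ → Finset (Fin m) → ℝ}
    (hω : IsLocalDensitySystem m R W ω) (hW : W ≠ 0) {C₀ : ℝ} (hC₀ : ∀ u, |moebiusLogSum u| ≤ C₀)
    {S : Finset ℕ} (hS : S ⊆ primesUpTo R) (hSW : ∀ p ∈ S, ¬p ∣ W) :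
    |partialCorrelationSum m R ω S| ≤
      (C₀ ^ 2 * eulerFactorProd 1 W.primeFactors ^ 2 * ∑ r ∈ (Finset.Icc 1 ⌊R⌋₊).filter Squarefree, 1 / (r.totient : ℝ)) ^ m *
        ∏ p ∈ S, (16 : ℝ) ^ m / (p : ℝ) ^ 2 := by
  classical
  set G : ℝ := ∑ r ∈ (Finset.Icc 1 ⌊R⌋₊).filter Squarefree, 1 / (r.totient : ℝ) with hG
  set EW := eulerFactorProd 1 W.primeFactors with hEW
  set Ub : ℝ := (C₀ ^ 2 * (EW * 2 ^ S.card) ^ 2 * G) ^ m with hUb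
  have hη : ∀ σ : Fin m ⊕ Fin m → Finset ℕ, |∏ p ∈ S, pertDensity ω p (projPattern (patSet σ p))| ≤
      ∏ p ∈ S, 1 / (p : ℝ) ^ 2 := by
    intro σ
    rw [abs_prod]
    exact prod_le_prod (fun p _ => abs_nonneg _) fun p hp => abs_pertDensity_le hω (hS hp) (hSW p hp) _
  rw [partialCorrelationSum_eq_sum_patterns]
  calc |∑ σ ∈ patterns m S, (∏ p ∈ S, pertDensity ω p (projPattern (patSet σ p))) * fiberSum R ω S σ|
      ≤ ∑ σ ∈ patterns m S, |(∏ p ∈ S, pertDensity ω p (projPattern (patSet σ p))) * fiberSum R ω S σ| :=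
        abs_sum_le_sum_abs _ _
    _ ≤ ∑ _σ ∈ patterns m S, (∏ p ∈ S, 1 / (p : ℝ) ^ 2) * Ub := by
        refine sum_le_sum fun σ hσ => ?_
        rw [abs_mul]
        exact mul_le_mul (hη σ) (abs_fiberSum_le hω hW hC₀ hS hσ) (abs_nonneg _) (prod_nonneg fun p _ => by positivity)
    _ = (2 ^ S.card) ^ (m + m) * ((∏ p ∈ S, 1 / (p : ℝ) ^ 2) * Ub) := by
        rw [sum_const, card_patterns, nsmul_eq_mul]; push_cast; ring
    _ = (C₀ ^ 2 * EW ^ 2 * G) ^ m * ∏ p ∈ S, (16 : ℝ) ^ m / (p : ℝ) ^ 2 := by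
        rw [hUb, show ((16 : ℝ) ^ m) = 2 ^ (4 * m) by rw [pow_mul]; norm_num, prod_div_distrib, prod_const,
          prod_div_distrib, prod_const]
        ring

/-- **The comparison**: for a local density system at the primes `p ≤ R` (`W ≥ 1`) and
`C₀ = sup |M₁|`,
`|T(ω) - S_W(R)^m| ≤ (C₀² (W/φ(W))² G(R))^m (∏_{p ≤ R, p ∤ W} (1 + 16^m/p²) - 1)`,
`G(R) = ∑_{r ≤ R} μ²(r)/φ(r)` (`≤ e⁵ log R`, `sum_sq_moebius_div_totient_le`). [cite: GreenTaoAnnals2008, Section 10] -/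
theorem abs_correlationSum_sub_pow_le {R : ℝ} {W : ℕ} {ω : ℕ → Finset (Fin m) → ℝ}
    (hω : IsLocalDensitySystem m R W ω) (hW : W ≠ 0) {C₀ : ℝ} (hC₀ : ∀ u, |moebiusLogSum u| ≤ C₀) :
    |correlationSum m R ω - selbergS W R ^ m| ≤
      (C₀ ^ 2 * eulerFactorProd 1 W.primeFactors ^ 2 * ∑ r ∈ (Finset.Icc 1 ⌊R⌋₊).filter Squarefree, 1 / (r.totient : ℝ)) ^ m *
        (∏ p ∈ (primesUpTo R).filter (fun p => ¬p ∣ W), (1 + (16 : ℝ) ^ m / (p : ℝ) ^ 2) - 1) := by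
  classical
  set P := primesUpTo R with hP
  set P' := P.filter (fun p => ¬p ∣ W) with hP'
  set K : ℝ := (C₀ ^ 2 * eulerFactorProd 1 W.primeFactors ^ 2 *
    ∑ r ∈ (Finset.Icc 1 ⌊R⌋₊).filter Squarefree, 1 / (r.totient : ℝ)) ^ m with hK
  set a : ℕ → ℝ := fun p => (16 : ℝ) ^ m / (p : ℝ) ^ 2 with ha
  have hK0 : 0 ≤ K := by
    rw [hK]
    refine pow_nonneg (mul_nonneg (mul_nonneg (sq_nonneg _) (sq_nonneg _)) (sum_nonneg fun r _ => by positivity)) m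
  have ha0 : ∀ p, 0 ≤ a p := fun p => by rw [ha]; positivity
  -- `T - S^m = ∑_{S ≠ ∅} V(S)`
  have h0 : ∅ ∈ P.powerset := empty_mem_powerset P
  have hdiff : correlationSum m R ω - selbergS W R ^ m = ∑ S ∈ P.powerset.erase ∅, partialCorrelationSum m R ω S := by
    rw [correlationSum_eq_sum_powerset, ← hP, ← sum_erase_add _ _ h0, partialCorrelationSum_empty,
      correlationSum_indep hω]
    ring
  -- the sets with a prime of `W` contribute nothing
  have hvanish : ∀ S ∈ P.powerset.erase ∅, S ∉ P'.powerset.erase ∅ → |partialCorrelationSum m R ω S| = 0 := by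
    intro S hS hS'
    have hSP : S ⊆ P := mem_powerset.1 (mem_of_mem_erase hS)
    have hSne : S ≠ ∅ := ne_of_mem_erase hS
    have hnot : ¬S ⊆ P' := fun h => hS' (mem_erase.2 ⟨hSne, mem_powerset.2 h⟩)
    obtain ⟨p, hpS, hpP'⟩ := Finset.not_subset.1 hnot
    have hpW : p ∣ W := by
      by_contra h
      exact hpP' (mem_filter.2 ⟨hSP hpS, h⟩)
    rw [partialCorrelationSum_eq_zero_of_dvd hω hSP hpS hpW, abs_zero]
  have hsub : P'.powerset.erase ∅ ⊆ P.powerset.erase ∅ :=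
    erase_subset_erase _ (powerset_mono.2 (filter_subset _ _))
  rw [hdiff]
  calc |∑ S ∈ P.powerset.erase ∅, partialCorrelationSum m R ω S|
      ≤ ∑ S ∈ P.powerset.erase ∅, |partialCorrelationSum m R ω S| := abs_sum_le_sum_abs _ _
    _ = ∑ S ∈ P'.powerset.erase ∅, |partialCorrelationSum m R ω S| := (sum_subset hsub hvanish).symm
    _ ≤ ∑ S ∈ P'.powerset.erase ∅, K * ∏ p ∈ S, a p := by
        refine sum_le_sum fun S hS => ?_
        have hSP' : S ⊆ P' := mem_powerset.1 (mem_of_mem_erase hS)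
        have hSP : S ⊆ P := hSP'.trans (filter_subset _ _)
        have hSW : ∀ p ∈ S, ¬p ∣ W := fun p hp => (mem_filter.1 (hSP' hp)).2
        exact abs_partialCorrelationSum_le hω hW hC₀ hSP hSW
    _ = K * (∏ p ∈ P', (1 + a p) - 1) := by
        rw [← mul_sum, prod_one_add, ← sum_erase_add _ _ (empty_mem_powerset P'), Finset.prod_empty]
        ring

/-- **`∏_{w < p ≤ R}(1 + a/p²) - 1 ≤ 2a/w`** for `0 ≤ a ≤ w` (`∑_{n > w} 1/n² ≤ 1/w`, `e^x - 1 ≤ 2x` for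
`0 ≤ x ≤ 1`). [folklore] -/
theorem prod_one_add_div_sq_sub_one_le {w : ℕ} (hw : 1 ≤ w) {a : ℝ} (ha : 0 ≤ a) (haw : a ≤ (w : ℝ))
    (P : Finset ℕ) (hP : ∀ p ∈ P, w < p) :
    ∏ p ∈ P, (1 + a / (p : ℝ) ^ 2) - 1 ≤ 2 * a / (w : ℝ) := by
  have hw0 : (0 : ℝ) < w := by exact_mod_cast hw
  -- `∑_{p ∈ P} 1/p² ≤ 1/w`
  have hsum : ∑ p ∈ P, 1 / (p : ℝ) ^ 2 ≤ 1 / (w : ℝ) := by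
    rcases P.eq_empty_or_nonempty with rfl | hne
    · rw [sum_empty]; positivity
    · set N := P.sup id with hN
      have hPsub : P ⊆ Finset.Ioc w N := fun p hp =>
        Finset.mem_Ioc.2 ⟨hP p hp, by rw [hN]; exact Finset.le_sup (f := id) hp⟩
      have hwN : w ≤ N := by
        obtain ⟨p, hp⟩ := hne
        exact (hP p hp).le.trans (by rw [hN]; exact Finset.le_sup (f := id) hp)
      calc ∑ p ∈ P, 1 / (p : ℝ) ^ 2 ≤ ∑ p ∈ Finset.Ioc w N, 1 / (p : ℝ) ^ 2 :=
            sum_le_sum_of_subset_of_nonneg hPsub fun p _ _ => by positivity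
        _ = ∑ p ∈ Finset.Ioc w N, ((p : ℝ) ^ 2)⁻¹ := sum_congr rfl fun p _ => one_div _
        _ ≤ (w : ℝ)⁻¹ - (N : ℝ)⁻¹ := sum_Ioc_inv_sq_le_sub (by omega) hwN
        _ ≤ 1 / (w : ℝ) := by rw [one_div]; linarith [inv_nonneg.2 (Nat.cast_nonneg (α := ℝ) N)]
  have hx : ∑ p ∈ P, a / (p : ℝ) ^ 2 ≤ a / (w : ℝ) := by
    have : ∑ p ∈ P, a / (p : ℝ) ^ 2 = a * ∑ p ∈ P, 1 / (p : ℝ) ^ 2 := by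
      rw [mul_sum]; exact sum_congr rfl fun p _ => by ring
    rw [this, div_eq_mul_one_div a (w : ℝ)]
    exact mul_le_mul_of_nonneg_left hsum ha
  have hx0 : 0 ≤ ∑ p ∈ P, a / (p : ℝ) ^ 2 := sum_nonneg fun p _ => by positivity
  have haw1 : a / (w : ℝ) ≤ 1 := (div_le_one hw0).2 haw
  have hexp : ∏ p ∈ P, (1 + a / (p : ℝ) ^ 2) ≤ Real.exp (∑ p ∈ P, a / (p : ℝ) ^ 2) :=
    SquarefreeSums.prod_one_add_le_exp_sum fun p _ => by positivity
  have hbd : Real.exp (∑ p ∈ P, a / (p : ℝ) ^ 2) - 1 ≤ 2 * (a / (w : ℝ)) := by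
    have h1 : Real.exp (∑ p ∈ P, a / (p : ℝ) ^ 2) ≤ Real.exp (a / (w : ℝ)) := Real.exp_le_exp.2 hx
    have h2 : |Real.exp (a / (w : ℝ)) - 1| ≤ 2 * |a / (w : ℝ)| :=
      Real.abs_exp_sub_one_le (by rw [abs_of_nonneg (by positivity)]; exact haw1)
    rw [abs_of_nonneg (by positivity : 0 ≤ a / (w : ℝ))] at h2
    linarith [le_abs_self (Real.exp (a / (w : ℝ)) - 1)]
  calc ∏ p ∈ P, (1 + a / (p : ℝ) ^ 2) - 1 ≤ Real.exp (∑ p ∈ P, a / (p : ℝ) ^ 2) - 1 := by linarith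
    _ ≤ 2 * (a / (w : ℝ)) := hbd
    _ = 2 * a / (w : ℝ) := by ring

end Literature.NumberTheory.Sieve.GreenTao2008
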